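import Mathlib

/-!
# Crux `HilbertIntegralOverconvergentIsCongruence` (stmt-Langlands-8485), line `Sketch-ideate-r1-k1`:
# stub `stub_mvCoeffMulBound` — ultrametric product rule for multivariable power series

Over a nonarchimedean normed field `K`, coefficientwise bounds `‖φ‖ ≤ A`, `‖ψ‖ ≤ B` for two
multivariable formal power series give `‖φ ψ‖ ≤ A B` coefficientwise (each coefficient of the product is
a finite sum of products `φ_s ψ_t`, `s + t = n`, and the norm is ultrametric).  The `d`-variable analogue
of `norm_coeff_mul_le_of_forall_le` (file `…StubCoeffMulBound.lean`), consumed by the `d`-free Katz–Sturm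
lever `stub_katzSturmAbstract`.  Theorems only.
-/

set_option linter.dupNamespace false -- `Summit.Langlands.Langlands` is the mandated namespace

namespace Summit.Langlands.Langlands.Theorems.HilbertIntegralOverconvergentIsCongruence

/-- **Stub `stub_mvCoeffMulBound`.**  `K` a nonarchimedean normed field, `σ` any index type: if the
coefficients of `φ ψ : MvPowerSeries σ K` are bounded in norm by `A ≥ 0` and `B ≥ 0` respectively, then
every coefficient of `φ * ψ` has norm `≤ A * B`. [folklore] -/
theorem stub_mvCoeffMulBound {K σ : Type*} [NormedField K] [IsUltrametricDist K]
    (φ ψ : MvPowerSeries σ K) (A B : ℝ) (hA : 0 ≤ A) (hB : 0 ≤ B)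
    (hφ : ∀ n, ‖MvPowerSeries.coeff n φ‖ ≤ A) (hψ : ∀ n, ‖MvPowerSeries.coeff n ψ‖ ≤ B) :
    ∀ n, ‖MvPowerSeries.coeff n (φ * ψ)‖ ≤ A * B := by
  classical
  intro n
  rw [MvPowerSeries.coeff_mul]
  refine IsUltrametricDist.norm_sum_le_of_forall_le_of_nonneg (mul_nonneg hA hB) fun x _ => ?_
  rw [norm_mul]
  exact mul_le_mul (hφ x.1) (hψ x.2) (norm_nonneg _) hA

end Summit.Langlands.Langlands.Theorems.HilbertIntegralOverconvergentIsCongruence
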